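import Literature.Topology.CoveringSpaces.AssociatedCovering
import Literature.Topology.CoveringSpaces.UniversalCoverLift
import Mathlib.Topology.Homotopy.Lifting
import Mathlib.Topology.Connected.LocallyPathConnected
import HarnessLib

/-!
# Every `π₁(X, x₀)`-set is the fibre of a covering space: the cover `X̃ ×_{π₁} S → X` associated with a
# `π₁`-set, and the lift of the universal cover through any covering map (Hatcher §1.3, pp. 68–70)

Topic `Literature/Topology/CoveringSpaces`.  Sequel of `AssociatedCovering` (for a quotient covering map
`f : E → X` of a `G`-action and a `G`-set `S`: the covering map `E ×_G S → X` with fibre `S`) and of the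
tree's universal cover `UniversalCover X x₀` (`UniversalCover.lean`, `UniversalCoverLift.lean`: the
quotient covering map `p : X̃ → X` of the deck action of `π₁(X, x₀)`, Hatcher §1.3 pp. 63–65) for `X`
path connected and strongly locally contractible.  A. Hatcher, *Algebraic Topology* (2002), §1.3:

> (p. 68, Prop. 1.36 and p. 70) «… for an arbitrary action of `π₁(X, x₀)` on a set `F` … this makes
> `X̃ ×_{π₁} F → X` into a covering space with fibre `F` … Thus n-sheeted covering spaces of `X` are
> classified by … actions of `π₁(X, x₀)` on a set of `n` elements.»
> (Prop. 1.33/1.34) the lifting criterion and the uniqueness of lifts.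

What is here (all proved; no definitions beyond those of `AssociatedCovering`, no named facts):

* `UniversalCover.isPathConnected_tube`, `UniversalCover.locallyPathConnectedSpace` — the tubes
  `U_[γ]` are path connected, so `X̃` is locally path connected (needed by Mathlib's lifting criterion);
* `UniversalCover.exists_lift`, `lift_unique`, **`lift_apply_eq_monodromy`**, `lift_surjective` — the
  universal cover maps to every based covering space `q : Y → X` (`π₁(X̃) = 1`, Mathlib
  `IsCoveringMap.existsUnique_continuousMap_lifts`), the lift of `[γ]` is Mathlib's MONODROMY of `[γ]`
  applied to the base point, and the lift is onto when `Y` is path connected;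
* **`UniversalCover.isCoveringMap_assocProj`** — for EVERY `π₁(X, x₀)`-set `S` (discrete topology) the
  associated space `X̃ ×_{π₁} S → X` is a covering map;
* **`UniversalCover.assocFibreEquiv_monodromy`** — its fibre over `x₀` is `S` EQUIVARIANTLY: under
  `assocFibreEquiv : fibre_{x₀} ≃ S`, Mathlib's monodromy action of `γ ∈ π₁(X, x₀)` on the fibre is
  `s ↦ γ • s` (the lift of a loop `γ` from `[(x̃₀, s)]` ends at `[(γ⁻¹ • x̃₀, s)] = [(x̃₀, γ • s)]`);
  packaged as `UniversalCover.exists_covering_realising` (essential surjectivity of the fibre functor).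

Half (C) of the abc-iut cell's campaign-L row G-L4t14-R1 (topological Galois correspondence for covers;
partner files by abc-iut-w5-d144); purely classical topology.

## References

* A. Hatcher, *Algebraic Topology*, CUP 2002, §1.3 Prop. 1.33, 1.34, 1.36, Thm. 1.38, pp. 68–70.
  [HatcherAT2002]
-/

noncomputable section

open Set Filter Topology TopologicalSpace unitInterval MulAction

namespace Literature.Topology.CoveringSpaces

universe u w

namespace UniversalCover

variable {X : Type u} [TopologicalSpace X] {x₀ : X}

/-- **Tubes are path connected**: every `b ∈ U_[a]` is joined to `a` inside `U_[a]` by the lift of the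
path `η ⊆ U` defining it (`t ↦ [γ_t]`). [cite: HatcherAT2002, §1.3 p. 65] -/
theorem isPathConnected_tube {U : Set X} {a : UniversalCover X x₀} (ha : a.pt ∈ U) :
    IsPathConnected (tube U a) := by
  refine ⟨a, mem_tube_self ha, fun b hb ↦ ?_⟩
  obtain ⟨η, hη, hb⟩ := hb
  -- the lift of `η` from `a` stays in the tube and ends at `b`
  have hmem : ∀ s, lift a η s ∈ tube U a := fun s ↦
    ⟨head η s, fun t ↦ hη (seg 0 s t), rfl⟩
  have hend : b = ⟨b.pt, a.cls.trans (Path.Homotopic.Quotient.mk η)⟩ := by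
    rcases b with ⟨y, c⟩
    change c = _ at hb
    rw [hb]
  exact ⟨(liftPath a η).cast rfl hend, fun s ↦ hmem s⟩

/-- **The universal cover is locally path connected** (the path connected tubes over good sets form a
neighbourhood basis). [cite: HatcherAT2002, §1.3 p. 64–65] -/
theorem locallyPathConnectedSpace [StronglyLocallyContractibleSpace X] :
    LocallyPathConnectedSpace (UniversalCover X x₀) := by
  refine LocallyPathConnectedSpace.of_bases (p := fun a (U : Set X) ↦ U ∈ goodSets X ∧ a.pt ∈ U)
    (s := fun a U ↦ tube U a) (fun a ↦ ⟨fun O ↦ ⟨fun hO ↦ ?_, ?_⟩⟩) ?_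
  · obtain ⟨S, ⟨U, b, hU, hb, rfl⟩, haS, hSO⟩ := isTopologicalBasis_tube.mem_nhds_iff.1 hO
    exact ⟨U, ⟨hU, proj_mem_of_mem_tube haS⟩, (tube_eq_of_mem haS).le.trans hSO⟩
  · rintro ⟨U, ⟨hU, haU⟩, hUO⟩
    exact mem_of_superset (tube_mem_nhds hU.1 haU) hUO
  · rintro a U ⟨-, haU⟩
    exact isPathConnected_tube haU

/-! ### The lift of `p : X̃ → X` through a covering map -/

section Lift

variable [PathConnectedSpace X] [StronglyLocallyContractibleSpace X]
  {Y : Type*} [TopologicalSpace Y] {q : Y → X}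

/-- **The universal cover maps to every based covering space**: for a covering map `q : Y → X` and
`y₀ ∈ q⁻¹(x₀)` there is a continuous `φ : X̃ → Y` with `φ(x̃₀) = y₀` and `q ∘ φ = p` (the lifting
criterion, `π₁(X̃) = 1`). [cite: HatcherAT2002, §1.3 Prop. 1.33, p. 70 («universal» cover)] -/
theorem exists_lift (hq : IsCoveringMap q) (y₀ : Y) (hy : q y₀ = x₀) :
    ∃ φ : C(UniversalCover X x₀, Y), φ (base X x₀) = y₀ ∧ q ∘ φ = proj := by
  haveI := locallyPathConnectedSpace (X := X) (x₀ := x₀)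
  obtain ⟨φ, ⟨h0, hφ⟩, -⟩ := hq.existsUnique_continuousMap_lifts
    (⟨proj, continuous_proj⟩ : C(UniversalCover X x₀, X)) (base X x₀) y₀ (by rw [hy]; rfl)
  exact ⟨φ, h0, hφ⟩

omit [PathConnectedSpace X] [StronglyLocallyContractibleSpace X] in
/-- Two lifts of `p` through `q` that agree at one point agree everywhere (`X̃` is path connected).
[cite: HatcherAT2002, §1.3 Prop. 1.34] -/
theorem lift_unique (hq : IsCoveringMap q) {φ ψ : C(UniversalCover X x₀, Y)}
    (hφ : q ∘ φ = proj) (hψ : q ∘ ψ = proj) {a : UniversalCover X x₀} (h : φ a = ψ a) : φ = ψ := by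
  have := hq.eq_of_comp_eq φ.continuous ψ.continuous (hφ.trans hψ.symm) a h
  exact ContinuousMap.ext fun b ↦ congrFun this b

omit [PathConnectedSpace X] [StronglyLocallyContractibleSpace X] in
/-- **The lift is the monodromy**: if `q ∘ φ = p` and `φ(x̃₀) = y₀`, then `φ([γ])` is the endpoint of the
`q`-lift of `γ` from `y₀`, i.e. Mathlib's monodromy of the class `[γ]` applied to `y₀`.
[cite: HatcherAT2002, §1.3 p. 69 (proof of Prop. 1.36), Prop. 1.34] -/
theorem lift_apply_eq_monodromy (hq : IsCoveringMap q) {φ : C(UniversalCover X x₀, Y)} {y₀ : Y}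
    (hy : q y₀ = x₀) (h0 : φ (base X x₀) = y₀) (hφ : q ∘ φ = proj) (a : UniversalCover X x₀) :
    φ a = ((hq.monodromy a.cls ⟨y₀, hy⟩ : q ⁻¹' {a.pt}) : Y) := by
  rcases a with ⟨x, c⟩
  induction c using Quotient.inductionOn with
  | h γ =>
    -- the lift of `γ` to `X̃` from the base point, pushed to `Y` by `φ`, is the `q`-lift of `γ` from `y₀`
    have hL : (φ : UniversalCover X x₀ → Y) ∘ lift (base X x₀) γ =
        hq.liftPath (γ : C(I, X)) y₀ (by rw [hy]; exact γ.source) := by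
      rw [hq.eq_liftPath_iff]
      refine ⟨φ.continuous.comp (continuous_lift _ _), ?_, ?_⟩
      · funext s
        exact congrFun hφ (lift (base X x₀) γ s)
      · change φ (lift (base X x₀) γ 0) = y₀
        rw [lift_zero, h0]
    have h1 : (⟨x, (⟦γ⟧ : Path.Homotopic.Quotient x₀ x)⟩ : UniversalCover X x₀) = lift (base X x₀) γ 1 := by
      rw [lift_one]
      change _ = (⟨x, (Path.Homotopic.Quotient.refl x₀).trans (Path.Homotopic.Quotient.mk γ)⟩ :
        UniversalCover X x₀)
      rw [Path.Homotopic.Quotient.refl_trans]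
      rfl
    calc φ ⟨x, (⟦γ⟧ : Path.Homotopic.Quotient x₀ x)⟩
        = ((φ : UniversalCover X x₀ → Y) ∘ lift (base X x₀) γ) 1 := by rw [h1]; rfl
      _ = hq.liftPath (γ : C(I, X)) y₀ (by rw [hy]; exact γ.source) 1 := by rw [hL]
      _ = _ := rfl

omit [PathConnectedSpace X] [StronglyLocallyContractibleSpace X] in
/-- **The lift is onto a path connected cover**: every `y ∈ Y` is `φ` of the class of the projection of
a path from `y₀` to `y`. [cite: HatcherAT2002, §1.3 p. 70 (the universal cover covers every path connected cover)] -/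
theorem lift_surjective [PathConnectedSpace Y] (hq : IsCoveringMap q) {φ : C(UniversalCover X x₀, Y)}
    {y₀ : Y} (hy : q y₀ = x₀) (h0 : φ (base X x₀) = y₀) (hφ : q ∘ φ = proj) :
    Function.Surjective φ := by
  subst hy
  intro y
  -- a path `δ` from `y₀` to `y`; its projection `q ∘ δ` as a class from `q y₀`
  let δ : Path y₀ y := (PathConnectedSpace.joined y₀ y).somePath
  refine ⟨⟨q y, (Path.Homotopic.Quotient.mk δ).map ⟨q, hq.continuous⟩⟩, ?_⟩
  rw [lift_apply_eq_monodromy hq rfl h0 hφ]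
  -- the monodromy of `q ∘ δ` from `y₀` is `δ(1) = y`
  change ((hq.monodromy ((Path.Homotopic.Quotient.mk δ).map ⟨q, hq.continuous⟩) ⟨y₀, rfl⟩ :
    q ⁻¹' {q y}) : Y) = y
  rw [hq.monodromy_map]

end Lift



/-! ### The covering space associated with a `π₁(X, x₀)`-set -/

section Assoc

variable [PathConnectedSpace X] [StronglyLocallyContractibleSpace X]
  {S : Type w} [MulAction (FundamentalGroup X x₀) S] [TopologicalSpace S] [DiscreteTopology S]

/-- **`X̃ ×_{π₁} S → X` is a covering map** for every `π₁(X, x₀)`-set `S` (X path connected and strongly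
locally contractible). [cite: HatcherAT2002, §1.3 p. 70] -/
theorem isCoveringMap_assocProj :
    IsCoveringMap (assocProj (isQuotientCoveringMap_proj (X := X) (x₀ := x₀)) S) :=
  Literature.Topology.CoveringSpaces.isCoveringMap_assocProj _

omit [TopologicalSpace S] [DiscreteTopology S] in
/-- The projection of the associated cover on classes: `[(a, s)] ↦ p a`. [cite: HatcherAT2002, §1.3 p. 70] -/
theorem assocProj_assocMk_eq (a : UniversalCover X x₀) (s : S) :
    assocProj (isQuotientCoveringMap_proj (X := X) (x₀ := x₀)) S (assocMk (a, s)) = proj a := rfl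

/-- **The path `t ↦ [(lift of γ, s)]` is the lift to `X̃ ×_{π₁} S` of the loop `γ` from `[(x̃₀, s)]`**, so
the monodromy of `[γ]` sends `[(x̃₀, s)]` to `[(endpoint of the lift of γ to X̃, s)]`.
[cite: HatcherAT2002, §1.3 p. 69–70] -/
theorem monodromy_assocMk_base (γ : Path x₀ x₀) (s : S) :
    (((isCoveringMap_assocProj (X := X) (x₀ := x₀) (S := S)).monodromy
        (⟦γ⟧ : Path.Homotopic.Quotient x₀ x₀)
        (⟨assocMk (base X x₀, s), rfl⟩ :
          assocProj (isQuotientCoveringMap_proj (X := X) (x₀ := x₀)) S ⁻¹' {proj (base X x₀)}) :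
        assocProj (isQuotientCoveringMap_proj (X := X) (x₀ := x₀)) S ⁻¹' {proj (base X x₀)}) :
      AssocSpace (FundamentalGroup X x₀) (UniversalCover X x₀) S) =
      assocMk (lift (base X x₀) γ 1, s) := by
  set hE := isCoveringMap_assocProj (X := X) (x₀ := x₀) (S := S) with hEdef
  -- the explicit lift of `γ`
  have hL : (fun t ↦ (assocMk (lift (base X x₀) γ t, s) :
      AssocSpace (FundamentalGroup X x₀) (UniversalCover X x₀) S)) =
      hE.liftPath (γ : C(I, X)) (assocMk (base X x₀, s)) (by exact γ.source) := by
    rw [hE.eq_liftPath_iff]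
    refine ⟨continuous_assocMk.comp ((continuous_lift _ _).prodMk continuous_const), ?_, ?_⟩
    · funext t
      rfl
    · change (assocMk (lift (base X x₀) γ 0, s) : AssocSpace _ _ S) = _
      rw [lift_zero]
  have h1 : (((hE.monodromy (⟦γ⟧ : Path.Homotopic.Quotient x₀ x₀)
      (⟨assocMk (base X x₀, s), rfl⟩ :
        assocProj (isQuotientCoveringMap_proj (X := X) (x₀ := x₀)) S ⁻¹' {proj (base X x₀)})) :
        assocProj (isQuotientCoveringMap_proj (X := X) (x₀ := x₀)) S ⁻¹' {proj (base X x₀)}) :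
        AssocSpace (FundamentalGroup X x₀) (UniversalCover X x₀) S) =
      hE.liftPath (γ : C(I, X)) (assocMk (base X x₀, s)) (by exact γ.source) 1 := rfl
  rw [h1, ← hL]

omit [PathConnectedSpace X] [StronglyLocallyContractibleSpace X] in
/-- The endpoint of the lift of a loop `γ` to `X̃` from the base point is `[γ]⁻¹ • x̃₀` for the deck
action. [cite: HatcherAT2002, §1.3 Prop. 1.39] -/
theorem lift_base_one_eq_smul (γ : Path x₀ x₀) :
    lift (base X x₀) γ 1 = (FundamentalGroup.fromPath ⟦γ⟧ : FundamentalGroup X x₀)⁻¹ • base X x₀ := by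
  rw [lift_one, smul_def, inv_inv]
  change (⟨x₀, (Path.Homotopic.Quotient.refl x₀).trans ⟦γ⟧⟩ : UniversalCover X x₀) =
    ⟨x₀, Path.Homotopic.Quotient.trans (⟦γ⟧ : Path.Homotopic.Quotient x₀ x₀)
      (Path.Homotopic.Quotient.refl x₀)⟩
  rw [Path.Homotopic.Quotient.refl_trans, Path.Homotopic.Quotient.trans_refl]

omit [TopologicalSpace S] [DiscreteTopology S] in
/-- Every point of the fibre over `x₀` is `[(x̃₀, s)]` for some `s`. [cite: HatcherAT2002, §1.3 p. 70] -/
theorem exists_eq_assocMk_base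
    (q : assocProj (isQuotientCoveringMap_proj (X := X) (x₀ := x₀)) S ⁻¹' {x₀}) :
    ∃ s : S, (q : AssocSpace (FundamentalGroup X x₀) (UniversalCover X x₀) S) =
      assocMk (base X x₀, s) :=
  ⟨assocFibreEquiv (isQuotientCoveringMap_proj (X := X) (x₀ := x₀)) (base X x₀) q,
    congrArg Subtype.val
      ((assocFibreEquiv (isQuotientCoveringMap_proj (X := X) (x₀ := x₀)) (base X x₀)).symm_apply_apply
        q).symm⟩

/-- **The fibre of `X̃ ×_{π₁} S` over `x₀` is `S`, EQUIVARIANTLY for the monodromy**: transporting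
Mathlib's monodromy of `γ ∈ π₁(X, x₀)` along `assocFibreEquiv : fibre_{x₀} ≃ S` gives `s ↦ γ • s`
(the lift of a loop `γ` from `[(x̃₀, s)]` ends at `[(γ⁻¹ • x̃₀, s)] = [(x̃₀, γ • s)]`).
[cite: HatcherAT2002, §1.3 p. 70] -/
theorem assocFibreEquiv_monodromy (γ : FundamentalGroup X x₀)
    (q : assocProj (isQuotientCoveringMap_proj (X := X) (x₀ := x₀)) S ⁻¹' {x₀}) :
    assocFibreEquiv (isQuotientCoveringMap_proj (X := X) (x₀ := x₀)) (base X x₀)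
        ((isCoveringMap_assocProj (X := X) (x₀ := x₀) (S := S)).monodromy γ.toPath q) =
      γ • assocFibreEquiv (isQuotientCoveringMap_proj (X := X) (x₀ := x₀)) (base X x₀) q := by
  -- the statement at the explicit point `[(x̃₀, s)]`, for a loop `γ`
  have key : ∀ (γ : Path x₀ x₀) (s : S),
      assocFibreEquiv (isQuotientCoveringMap_proj (X := X) (x₀ := x₀)) (base X x₀) ((isCoveringMap_assocProj (X := X) (x₀ := x₀) (S := S)).monodromy (⟦γ⟧ : Path.Homotopic.Quotient x₀ x₀)
        (⟨assocMk (base X x₀, s), rfl⟩ : assocProj (isQuotientCoveringMap_proj (X := X) (x₀ := x₀)) S ⁻¹' {proj (base X x₀)})) =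
      (FundamentalGroup.fromPath ⟦γ⟧ : FundamentalGroup X x₀) • assocFibreEquiv (isQuotientCoveringMap_proj (X := X) (x₀ := x₀)) (base X x₀)
        (⟨assocMk (base X x₀, s), rfl⟩ : assocProj (isQuotientCoveringMap_proj (X := X) (x₀ := x₀)) S ⁻¹' {proj (base X x₀)}) := by
    intro γ s
    -- the monodromy moves `[(x̃₀, s)]` to `[([γ]⁻¹ • x̃₀, s)]`
    have hm := monodromy_assocMk_base (X := X) (x₀ := x₀) (S := S) γ s
    rw [lift_base_one_eq_smul] at hm
    have hmem : assocProj (isQuotientCoveringMap_proj (X := X) (x₀ := x₀)) S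
        (assocMk ((FundamentalGroup.fromPath ⟦γ⟧ : FundamentalGroup X x₀)⁻¹ • base X x₀, s)) ∈
        ({proj (base X x₀)} : Set X) := rfl
    have h1 : (isCoveringMap_assocProj (X := X) (x₀ := x₀) (S := S)).monodromy (⟦γ⟧ : Path.Homotopic.Quotient x₀ x₀)
        (⟨assocMk (base X x₀, s), rfl⟩ : assocProj (isQuotientCoveringMap_proj (X := X) (x₀ := x₀)) S ⁻¹' {proj (base X x₀)}) = ⟨_, hmem⟩ :=
      Subtype.ext hm
    have h2 : assocFibreEquiv (isQuotientCoveringMap_proj (X := X) (x₀ := x₀)) (base X x₀)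
        (⟨assocMk (base X x₀, s), rfl⟩ : assocProj (isQuotientCoveringMap_proj (X := X) (x₀ := x₀)) S ⁻¹' {proj (base X x₀)}) = s :=
      assocFibreEquiv_assocMk (isQuotientCoveringMap_proj (X := X) (x₀ := x₀)) (base X x₀) s
    calc assocFibreEquiv (isQuotientCoveringMap_proj (X := X) (x₀ := x₀)) (base X x₀) ((isCoveringMap_assocProj (X := X) (x₀ := x₀) (S := S)).monodromy (⟦γ⟧ : Path.Homotopic.Quotient x₀ x₀)
          (⟨assocMk (base X x₀, s), rfl⟩ : assocProj (isQuotientCoveringMap_proj (X := X) (x₀ := x₀)) S ⁻¹' {proj (base X x₀)}))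
        = assocFibreEquiv (isQuotientCoveringMap_proj (X := X) (x₀ := x₀)) (base X x₀) ⟨_, hmem⟩ := by
          exact congrArg (assocFibreEquiv (isQuotientCoveringMap_proj (X := X) (x₀ := x₀)) (base X x₀)) h1
      _ = (FundamentalGroup.fromPath ⟦γ⟧ : FundamentalGroup X x₀)⁻¹⁻¹ • s :=
          assocFibreEquiv_assocMk_smul (isQuotientCoveringMap_proj (X := X) (x₀ := x₀)) (base X x₀) _ s hmem
      _ = _ := by rw [inv_inv, h2]
  obtain ⟨s, hs⟩ := exists_eq_assocMk_base q
  obtain ⟨v, hv⟩ := q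
  change v = _ at hs
  subst hs
  induction γ using Quotient.inductionOn with
  | h γ => exact key γ s

variable (S) in
/-- **Essential surjectivity of the fibre functor** (Hatcher Thm. 1.38, existence half; p. 70): for
every `π₁(X, x₀)`-set `S` there is a covering space `Y → X` (namely `X̃ ×_{π₁} S`) together with a
bijection of its fibre over `x₀` with `S` carrying Mathlib's monodromy action to the given action.
[cite: HatcherAT2002, §1.3 Thm. 1.38, p. 70] -/
theorem exists_covering_realising :
    ∃ (Y : Type (max u w)) (_ : TopologicalSpace Y) (q : Y → X) (hq : IsCoveringMap q)
      (φ : q ⁻¹' {x₀} ≃ S), ∀ (γ : FundamentalGroup X x₀) (e : q ⁻¹' {x₀}),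
        φ (hq.monodromy γ.toPath e) = γ • φ e :=
  ⟨AssocSpace (FundamentalGroup X x₀) (UniversalCover X x₀) S, inferInstance,
    assocProj (isQuotientCoveringMap_proj (X := X) (x₀ := x₀)) S, isCoveringMap_assocProj,
    assocFibreEquiv _ (base X x₀), assocFibreEquiv_monodromy⟩

end Assoc

end UniversalCover

end Literature.Topology.CoveringSpaces

end
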